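import Summits.BirchSwinnertonDyer.BirchSwinnertonDyer.Theorems.SignedLowerHalvesSmallImageLowerHalfBothSignsLambdaLowerThreeNsThetaPartnerOrientK
import Summits.BirchSwinnertonDyer.BirchSwinnertonDyer.Theorems.SignedLowerHalvesSmallImageLowerHalfBothSignsLambdaLowerThreeNsThetaPartnerArtinChar
import Summits.BirchSwinnertonDyer.BirchSwinnertonDyer.Theorems.SignedLowerHalvesSmallImageLowerHalfBothSignsLambdaLowerThreeNsThetaPartnerLTReduction
import Literature.NumberTheory.GaloisRepresentations.ArtinCharacterLocalGlobalProofs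
import HarnessLib

/-!
# ORIENTATION, class-field-theoretic form: the local component at the inert prime of the Hecke character
# of the dihedral constituent is `u ↦ Teich(ū)⁻¹` (bricks S2 + S3/S4 + S5 assembled)

Route `SignedLowerHalves`, child L `SmallImageLowerHalfBothSigns` (item stmt-BirchSwinnertonDyer-23599), line
proposal `rtt_w3`, stub K0₂@p `stub_heckeThetaPartner_ns` — brick S5 ("ORIENT-CFT") of the arithmetic half at an
ODD prime (width seat `bsd-line-slh-p3-w3` gen 9; memo `Lines/birth_acns-MEMO-w3-g9.md`).  THEOREMS ONLY (no
definition, no named fact, no `sorry`); ROUTE-INDEPENDENT.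

This is the input (O) of the memo — the one input of K0₂@p with no counterpart at `p = 2` — PROVED from the
tree's class field theory.  Setting: `E = W/ℚ` globally minimal, `p ≠ 2` good supersingular (`GoodSS W p`), a
frame `(e, Φ)` of `E[p]`, a field `k ⊆ M₂(𝔽_p)` of degree `2` with `Φ(ρ̄(Γ_ℚ)) ≤ N(kˣ)`, a number field `K`
whose absolute Galois group maps ONTO `U = ρ̄⁻¹(Φ⁻¹(kˣ))` under `res_{K/ℚ}` (`hU`, `hKU`: the dihedral field),
a place `v ∣ p` of `K` at which `p` is a uniformiser of `K_v` with residue field of `p²` elements (`p` INERT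
in the imaginary quadratic `K`), a residue embedding `ι : 𝓀(\bar K_v) → k̄_p = ℤ̄_p/𝔪` and `e : ℚ̄_p ≃ ℂ`.

* `kummerCharacter_congr` — bookkeeping: the Kummer character only depends on the exponent.
* **`exists_heckeCharacter_localComponent_eq`** — there are a ring embedding `j : k → k̄_p` (brick S2, ORIENT-G
  over `K_v`), a Teichmüller section `T` of exponent `p² − 1`, the Artin character `χ = e∘T∘j∘Φ∘ρ̄∘res_{K/ℚ}`
  (brick S3) and its finite-order Hecke character `η` (brick S4, global class field theory) with all their
  clauses, AND, for every local Artin map `a` of `K_v` (`IsLocalArtinMap`) and every `w` in the inertia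
  subgroup of the Weil group of `K_v`:

      `(η_v(a w))⁻¹ = e(T(ι(a(w) mod 𝔓)))`,

  i.e. **the local component of `η` at `v` is `u ↦ e(Teich(ι ū))⁻¹` on `𝒪_vˣ`** (`a` maps inertia onto `𝒪_vˣ`).
  Proof: local–global compatibility of class field theory (`artinCharacter_localGlobalCompatible_holds`, Neukirch
  VI (5.6), PROVED in the tree) gives `tr χ(res w) = η_v(a w)⁻¹`; `tr χ(res w) = e(T(j(Φρ̄(res res w))))` (S3);
  `j(Φρ̄(res res w)) = θ_{p²−1}(w)` (S2); `θ_{p²−1} = ψ₁` as `#𝓀_v = p²`; `ψ₁(w) = ι(χ_p(w) mod 𝔓) = ι(a(w) mod 𝔓)`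
  (brick S5-local `fundamentalCharacter_one_eq_residue_artin`: Lubin–Tate reciprocity `coe_lubinTateChar_toAbsGalois`).

With this, the matching condition `hM` of the Teichmüller twist (`…TeichmullerTwist.exists_isGrossencharakter_congr`)
reduces to "two embeddings `𝔽_{p²} → 𝔽̄_p` differ by a power of Frobenius" (brick S7).  BSD, crux L and the
stub are NOT proved here.

References: J. Neukirch, ANT VI (5.6), VII (10.6); J. Tate, Corvallis (1.4.1); J. Lubin–J. Tate 1965 Thm. 3;
J.-P. Serre, Invent. Math. 15 (1972) §1.7 Prop. 3, §1.11 Prop. 12.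
-/

set_option autoImplicit false
set_option linter.dupNamespace false

noncomputable section

open scoped Classical NumberField MatrixGroups
open IsDedekindDomain Field Matrix NumberField WeierstrassCurve Literature.NumberTheory.EllipticCurves
  Literature.NumberTheory.GaloisRepresentations Rat.HeightOneSpectrum
  Literature.NumberTheory.EllipticCurves.Rank1Residual Summit.BirchSwinnertonDyer.Rank1Residual
  Literature.NumberTheory.GaloisRepresentations.IsNonarchimedeanLocalField
  Literature.NumberTheory.GaloisRepresentations.ModPGaloisRep ValuativeRel Polynomial

namespace Summit.BirchSwinnertonDyer.BirchSwinnertonDyer.Theorems.SmallImageLambdaLowerThreeNsThetaPartner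

/-- The Kummer character depends on the exponent only through its value (bookkeeping for
`θ_{p²−1} = θ_{q−1}` when `q = p²`). [folklore] -/
theorem kummerCharacter_congr {F : Type} [Field F] [ValuativeRel F] [TopologicalSpace F]
    [IsNonarchimedeanLocalField F] {k' : Type} [Field k'] {n m : ℕ} (h : n = m) (hn : 0 < n) (hm : 0 < m)
    {a : 𝒪[F]} (ha : a ≠ 0) (ι : absIntegers 𝒪[F] F ⧸ absMaximalIdeal F →+* k') :
    kummerCharacter F hn ha ι = kummerCharacter F hm ha ι := by
  subst h; rfl

section Curve

variable (W : WeierstrassCurve ℚ) [W.IsElliptic] [W.IsGloballyMinimal] (p : ℕ) [Fact p.Prime]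
  (Φ : Multiplicative (AddAut (geomTorsion W p)) ≃* GL (Fin 2) (ZMod p))

set_option maxHeartbeats 400000 in
/-- **ORIENT-CFT: the local component at `v` of the Hecke character of the dihedral constituent.**  See the
module docstring. [cite: NeukirchANT1999, Ch. VI Prop. (5.6)] [cite: LubinTate1965, Thm. 3 and Cor.]
[cite: SerreInventiones1972, §1.7 Prop. 3, §1.11 Prop. 12] -/
theorem exists_heckeCharacter_localComponent_eq (hp2 : p ≠ 2) (hss : GoodSS W p)
    (e₀ : geomTorsion W p ≃+ (Fin 2 → ZMod p))
    (he₀ : ∀ (g : Multiplicative (AddAut (geomTorsion W p))) (x : geomTorsion W p),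
      e₀ (Multiplicative.toAdd g x) = ((Φ g : GL (Fin 2) (ZMod p)) : Matrix (Fin 2) (Fin 2) (ZMod p)) *ᵥ e₀ x)
    {k : Subalgebra (ZMod p) (Matrix (Fin 2) (Fin 2) (ZMod p))} (hk : IsField k)
    (h2 : Module.finrank (ZMod p) k = 2)
    (hGN : (galoisRepTorsion W p).range.map Φ.toMonoidHom ≤
      Subgroup.normalizer (Serre1972.unitGroup k : Set (GL (Fin 2) (ZMod p))))
    (K : Type) [Field K] [NumberField K]
    (hU : ((Serre1972.unitGroup k).comap Φ.toMonoidHom).comap (galoisRepTorsion W p) ≤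
      (absGaloisRestrict ℚ K).toMonoidHom.range)
    (hKU : ∀ τ : absoluteGaloisGroup K,
      Φ (galoisRepTorsion W p (absGaloisRestrict ℚ K τ)) ∈ Serre1972.unitGroup k)
    {v : HeightOneSpectrum (𝓞 K)} (hpv : (p : 𝓞 K) ∈ v.asIdeal)
    (hgen : ∀ c ∈ IsLocalRing.maximalIdeal (v.adicCompletionIntegers K),
      ((p : ℕ) : v.adicCompletionIntegers K) ∣ c)
    (hπ : (valuation (v.adicCompletion K)).IsUniformizer
      ((((p : ℕ) : 𝒪[v.adicCompletion K]) : 𝒪[v.adicCompletion K]) : v.adicCompletion K))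
    (hq : residueFieldCard (v.adicCompletion K) = p ^ 2)
    (ι : absIntegers 𝒪[v.adicCompletion K] (v.adicCompletion K) ⧸ absMaximalIdeal (v.adicCompletion K) →+*
      padicAlgClResidueField p)
    (e : PadicAlgCl p ≃+* ℂ) :
    ∃ (j : k →+* padicAlgClResidueField p) (T : padicAlgClResidueField p → padicAlgClIntegers p)
      (χ : FramedArtinRep K 1) (η : HeckeCharacter K),
      (∀ z, z ^ (p ^ 2 - 1) = 1 →
        (T z : PadicAlgCl p) ^ (p ^ 2 - 1) = 1 ∧ IsLocalRing.residue (padicAlgClIntegers p) (T z) = z) ∧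
      (∀ τ : absoluteGaloisGroup K,
        (j ⟨(Φ (galoisRepTorsion W p (absGaloisRestrict ℚ K τ)) : Matrix (Fin 2) (Fin 2) (ZMod p)), hKU τ⟩) ^
          (p ^ 2 - 1) = 1) ∧
      (∀ τ : absoluteGaloisGroup K,
        ((FramedRep.det χ τ : ℂˣ) : ℂ) =
          e (T (j ⟨(Φ (galoisRepTorsion W p (absGaloisRestrict ℚ K τ)) : Matrix (Fin 2) (Fin 2) (ZMod p)), hKU τ⟩))) ∧
      (∀ (ℓ : ℕ) [Fact ℓ.Prime], ℓ ≠ p → W.HasGoodReductionAtPrime ℓ →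
        ∀ w : HeightOneSpectrum (𝓞 K), (ℓ : 𝓞 K) ∈ w.asIdeal → χ.IsUnramifiedAt w) ∧
      η.IsFiniteOrder ∧
      (∀ w : HeightOneSpectrum (𝓞 K), η.IsUnramifiedAt w ↔ χ.IsUnramifiedAt w) ∧
      (∀ w : HeightOneSpectrum (𝓞 K), χ.IsUnramifiedAt w →
        ∀ 𝔓 ∈ w.primesAbove, ∀ F : absoluteGaloisGroup K, IsArithFrobAt (𝓞 K) F 𝔓 →
          η.valueAtUniformizer w =
            e (T (j ⟨(Φ (galoisRepTorsion W p (absGaloisRestrict ℚ K F)) : Matrix (Fin 2) (Fin 2) (ZMod p)), hKU F⟩))) ∧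
      (∀ (a : WeilGroup (v.adicCompletion K) →* (v.adicCompletion K)ˣ), IsLocalArtinMap (v.adicCompletion K) a →
        ∀ w : WeilGroup (v.adicCompletion K), w ∈ WeilGroup.inertia (v.adicCompletion K) →
          (((η.localComponent v (a w))⁻¹ : ℂˣ) : ℂ) =
            e (T (ι (residue (v.adicCompletion K)
              (algebraMap (v.adicCompletion K) (AlgebraicClosure (v.adicCompletion K)) (a w : v.adicCompletion K)))))) := by
  have hpP : p.Prime := Fact.out
  have hn : 0 < p ^ 2 - 1 := by
    have h2le : 2 ≤ p := hpP.two_le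
    have : 4 ≤ p ^ 2 := by nlinarith
    omega
  have hirr : Irreducible (((p : ℕ) : 𝒪[v.adicCompletion K])) := irreducible_of_isUniformizer' hπ
  -- S2: the ring embedding `j` with `j(Φρ̄(res res σ)) = θ_{p²−1}(σ)` on `I_{K_v}`
  obtain ⟨j, hj⟩ := exists_ringHom_apply_eq_kummerCharacter_baseChange W p Φ hp2 hss e₀ he₀ hk h2 hGN K hU
    hpv hgen hirr hn ι
  -- S3/S4: the Artin character and its Hecke character
  obtain ⟨T, χ, η, hT, hjpow, hdet, hunr, hfin, hηunr, hηval⟩ :=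
    exists_heckeCharacter_teichmuller W p Φ K hk h2 hKU j e
  refine ⟨j, T, χ, η, hT, hjpow, hdet, hunr, hfin, hηunr, hηval, fun a ha w hw ↦ ?_⟩
  -- local–global compatibility: `tr χ(res w) = η_v(a w)⁻¹`
  have hfrob : ∀ w : HeightOneSpectrum (𝓞 K), η.IsUnramifiedAt w →
      χ.HasFrobCharpolyAt w (X - C (η.valueAtUniformizer w)) := by
    intro w hw
    rw [FramedGaloisRep.hasFrobCharpolyAt_iff_of_rank_one]
    intro 𝔓 h𝔓 F hF
    rw [hηval w ((hηunr w).mp hw) 𝔓 h𝔓 F hF, ← hdet F, FramedRep.det_apply,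
      Matrix.GeneralLinearGroup.val_det_apply, Matrix.det_fin_one]
  have hlg := artinCharacter_localGlobalCompatible_holds K η hfin χ (fun w ↦ (hηunr w).symm) hfrob v a ha w
  set σ := absGaloisRestrict K (v.adicCompletion K) (WeilGroup.toAbsGalois (v.adicCompletion K) w) with hσdef
  have htr : ((χ σ : GL (Fin 1) ℂ) : Matrix (Fin 1) (Fin 1) ℂ).trace = ((FramedRep.det χ σ : ℂˣ) : ℂ) := by
    rw [Matrix.trace_fin_one, FramedRep.det_apply, Matrix.GeneralLinearGroup.val_det_apply, Matrix.det_fin_one]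
  rw [htr, hdet] at hlg
  rw [← hlg]
  -- S2 at `σ = toAbsGalois w ∈ I_{K_v}`
  have hwI : WeilGroup.toAbsGalois (v.adicCompletion K) w ∈ absInertia (v.adicCompletion K) :=
    WeilGroup.mem_inertia_iff.mp hw
  obtain ⟨hσ, hjσ⟩ := hj ⟨WeilGroup.toAbsGalois (v.adicCompletion K) w, hwI⟩
  congr 2
  rw [hjσ]
  -- `θ_{p²−1} = ψ₁` (`#𝓀_v = p²`) and `ψ₁(w) = ι(a(w) mod 𝔓)` (Lubin–Tate)
  have hnq : residueFieldCard (v.adicCompletion K) ^ 1 - 1 = p ^ 2 - 1 := by rw [pow_one, hq]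
  rw [kummerCharacter_congr hnq.symm hn (residueFieldCard_pow_sub_one_pos (v.adicCompletion K) one_ne_zero)
      hirr.ne_zero ι,
    ← fundamentalCharacter_of_ne_zero (v.adicCompletion K) one_ne_zero ι _ hirr]
  exact congrArg T (fundamentalCharacter_one_eq_residue_artin hπ ha ι hw hwI)

end Curve

end Summit.BirchSwinnertonDyer.BirchSwinnertonDyer.Theorems.SmallImageLambdaLowerThreeNsThetaPartner

end
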